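import Summits.QuantumFields.YangMills.Theorems.AtomicCalibrationRMirrorCalibrationKDefs
import Summits.QuantumFields.YangMills.Theorems.AtomicCalibrationRMirrorCalibration
import HarnessLib

/-!
# B6K `stub_mirrorCalibrationK` of «MirrorCalibration» REV 4 (stmt-QuantumFields-28169) — PROVED

Planner seat `ym-idea-11` g17; landing kit file **K2 of 4** (= HOME `g17/rev4/mc_b6k.lean` §D + §M, sha8 2b9f084f, with §0K imported from K1).

* §D exact dilation covariance in the compact currency — `lowerBoundsK_of_const_mul`, `lowerBoundsK_const_mul_iff`
  (pattern `UVSeamRec.UnitDilation.lowerBounds_const_mul_iff`);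
* §M `mirrorCalibrationK_proof : OnsetFloorsK → SubOnsetTwoPointCeilings → MirrorCalibratedUnitK` — the landed B6 proof (`mirrorCalibration_proof`,
  ✓p713478) re-run on the explicit compact witnesses through `jointOnsetUnit`; `stub_mirrorCalibrationK` BY NAME + SIGNATURE.

HONEST LABEL: soft analysis / calibration / bookkeeping on HYPOTHESES; nothing here proves NT, a β-uniform bound, the leaf 19868
unconditionally, any crux, rung or summit; nothing about Bałaban's RG or Clay is asserted; the Yang–Mills mass gap is NOT proved.
-/

set_option autoImplicit false

noncomputable section

open scoped BigOperators
open MeasureTheory Filter Topology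
open Literature.MathematicalPhysics.QuantumFieldTheory Literature.MathematicalPhysics.QuantumLattice
open Literature.Probability.LatticeModels (Site)
open Summit.QuantumFields.YangMills.Theorems.InfiniteVolume (stateMomentStr measurable_plane
  abs_integral_centred_prod_le_of_eventually eventually_torusSeparated eventually_le_of_strictMono)
open Summit.QuantumFields.YangMills.Theorems.InfVolRP (centreOffset centreOffset_time norm_centreOffset_le_one)
open Summit.QuantumFields.YangMills.Theorems.OnsetTautologyOnsetContraction (stateMomentStr_two abs_centredPlane_le
  abs_coord_le_of_ne_zero)
open Summit.QuantumFields.YangMills.Theses.OnsetTautology (AdmissibleAtomProfile)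
open Summit.QuantumFields.YangMills.Cruxes.OSLegsFromFemtoAndGap.DlrCollarTransfer

namespace Summit.QuantumFields.YangMills.Cruxes.AtomicCalibrationR.MirrorCalibration

variable {G : Type} [Group G] [TopologicalSpace G] [IsTopologicalGroup G] [CompactSpace G]
  [MeasurableSpace G] [BorelSpace G]

/-! ## §D Exact dilation covariance in the compact currency -/

/-- **Compact-witness floors at unit `c · a` give compact-witness floors at unit `a`** (`c > 0`): dilate the witnesses by `c`
(compact support and disjointness are preserved by the homeomorphism), divide the volume threshold by `c`. [folklore] -/
theorem lowerBoundsK_of_const_mul (r : LatticeRep G) {a : ℝ → ℝ} {c : ℝ} (hc : 0 < c)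
    (h : LowerBoundsK G r (fun β => c * a β)) : LowerBoundsK G r a := by
  obtain ⟨D, hD⟩ := UVSeamRec.UnitDilation.exists_dilation c hc.ne'
  obtain ⟨⟨v, ε, β₅, Λ₅, hvK, hv, hε, h2⟩, ⟨f, g, k, ε', β₅', Λ₅', hfK, hgK, hkK, hfg, hgk, hfk, hε', h3⟩⟩ := h
  have hcpt : ∀ w : SchwartzMap (EuclideanSpace ℝ (Fin 4)) ℝ, HasCompactSupport (w : EuclideanSpace ℝ (Fin 4) → ℝ) →
      HasCompactSupport (SchwartzMap.compCLMOfContinuousLinearEquiv ℝ D w : EuclideanSpace ℝ (Fin 4) → ℝ) := by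
    intro w hw
    rw [SchwartzMap.compCLMOfContinuousLinearEquiv_apply]
    exact hw.comp_homeomorph D.toHomeomorph
  refine ⟨⟨SchwartzMap.compCLMOfContinuousLinearEquiv ℝ D v, ε, β₅, Λ₅ / c, hcpt v hvK,
      UVSeamRec.UnitDilation.tsupport_compCLM_subset_pos D c hD hc hv, hε, fun β hβ L hL => ?_⟩,
    ⟨SchwartzMap.compCLMOfContinuousLinearEquiv ℝ D f, SchwartzMap.compCLMOfContinuousLinearEquiv ℝ D g,
      SchwartzMap.compCLMOfContinuousLinearEquiv ℝ D k, ε', β₅', Λ₅' / c, hcpt f hfK, hcpt g hgK, hcpt k hkK,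
      UVSeamRec.UnitDilation.disjoint_tsupport_compCLM D hfg, UVSeamRec.UnitDilation.disjoint_tsupport_compCLM D hgk,
      UVSeamRec.UnitDilation.disjoint_tsupport_compCLM D hfk, hε', fun β hβ L hL => ?_⟩⟩
  · rw [UVSeamRec.UnitDilation.Q2_theta_compCLM D c hD]
    exact h2 β hβ L (by rw [div_le_iff₀ hc] at hL; linarith [hL])
  · rw [UVSeamRec.UnitDilation.Q3_compCLM D c hD]
    exact h3 β hβ L (by rw [div_le_iff₀ hc] at hL; linarith [hL])

/-- **Exact dilation covariance of the compact-witness floors**: `LowerBoundsK G r (c · a) ↔ LowerBoundsK G r a`, `c > 0`. [folklore] -/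
theorem lowerBoundsK_const_mul_iff (r : LatticeRep G) (a : ℝ → ℝ) {c : ℝ} (hc : 0 < c) :
    LowerBoundsK G r (fun β => c * a β) ↔ LowerBoundsK G r a := by
  refine ⟨lowerBoundsK_of_const_mul r hc, fun h => ?_⟩
  have ha : a = fun β => c⁻¹ * (c * a β) := funext fun β => by field_simp
  rw [ha] at h
  exact lowerBoundsK_of_const_mul r (inv_pos.2 hc) h

/-! ## §M B6K: `OnsetFloorsK → SubOnsetTwoPointCeilings → MirrorCalibratedUnitK` -/

/-- **B6K — PROVED.**  As `mirrorCalibration_proof` (✓p713478) with the calibration run on the EXPLICIT compact witnesses through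
`jointOnsetUnit` at level `ε := min ε₁ ε₀`, and the floors at the dilated unit `K · a` assembled from the unit's floor clauses for
the same witnesses (`LowerBoundsK G r a`) and transported by `lowerBoundsK_const_mul_iff`. -/
theorem mirrorCalibrationK_proof
    (hF : OnsetFloorsK)
    (hT : Summit.QuantumFields.YangMills.Theses.SquareRootCeilings.SubOnsetTwoPointCeilings) :
    MirrorCalibratedUnitK := by
  intro G _ _ _ _ hG hcl
  letI : MeasurableSpace G := borel G
  haveI : BorelSpace G := ⟨rfl⟩
  -- §1 datum (compact witnesses), level, unit
  obtain ⟨r, v, f, g, h, ε₁, Λ₅, β₅, hvK, hfK, hgK, hhK, hv, hfg, hgh, hfh, hε₁, hfloor⟩ := hF G hG hcl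
  obtain ⟨ε₀, hε₀, hT'⟩ := hT G hG hcl r v f g h Λ₅
  have hεpos : 0 < min ε₁ ε₀ := lt_min hε₁ hε₀
  have hfloorε : ∀ β : ℝ, β₅ ≤ β → ∃ s : ℝ, 0 < s ∧ s ≤ 1 ∧
      (∀ L : ℕ, Λ₅ ≤ s * L → min ε₁ ε₀ ≤ Q2 G r β L s (thetaTest 4 v) v) ∧
      (∀ L : ℕ, Λ₅ ≤ s * L → min ε₁ ε₀ ≤ |Q3 G r β L s f g h|) := by
    intro β hβ
    obtain ⟨s, hs0, hs1, h2, h3⟩ := hfloor β hβ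
    exact ⟨s, hs0, hs1, fun L hL => (min_le_left _ _).trans (h2 L hL), fun L hL => (min_le_left _ _).trans (h3 L hL)⟩
  have hvan := fun (s₀ : ℝ) (hs₀ : 0 < s₀) =>
    Summit.QuantumFields.YangMills.Theorems.OnsetCalibration.onsetVanishes_proof G hG hcl r v f g h (min ε₁ ε₀) Λ₅ s₀
      hεpos hs₀
  obtain ⟨a, ha_pos, ha_le, ha0, -, hcal⟩ :=
    jointOnsetUnit r v f g h (min ε₁ ε₀) Λ₅ β₅ hεpos hv hfg hgh hfh hfloorε hvan
  obtain ⟨C, ℓ₄, β₄, hℓ₄, hC, hceil⟩ := hT' (min ε₁ ε₀) hεpos (min_le_right _ _)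
    ⟨β₅, fun β hβ => ⟨a β, ha_pos β, ha_le β, (hcal β hβ).1.1, (hcal β hβ).1.2⟩⟩
  -- §1K the compact-witness floors AT THE UNIT, for the same witnesses
  have hlbK : LowerBoundsK G r a :=
    ⟨⟨v, min ε₁ ε₀, β₅, Λ₅, hvK, hv, hεpos, fun β hβ L hL => (hcal β hβ).1.1 L hL⟩,
      ⟨f, g, h, min ε₁ ε₀, β₅, Λ₅, hfK, hgK, hhK, hfg, hgh, hfh, hεpos, fun β hβ L hL => (hcal β hβ).1.2 L hL⟩⟩
  -- §2 the torus two-point ceiling AT THE UNIT, from `β₈ := max β₄ β₅` on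
  have hceilU : ∀ β : ℝ, max β₄ β₅ ≤ β → ∀ (R : ℕ), 1 ≤ R → (R : ℝ) * a β ≤ ℓ₄ →
      ∀ (L : ℕ) (q q' : Fin 4 × Fin 4) (x y : Fin 4 → ℤ), q.1 < q.2 → q'.1 < q'.2 → 4 * R + 8 ≤ L →
      (∃ k : Fin 4, (2 * (R : ℤ) + 4) ≤ |((((x k - y k : ℤ) : ZMod (2 * L + 1))).valMinAbs : ℤ)|) →
      |torusE G r β L (fun U => (plane G r q x U - torusE G r β L (plane G r q x)) *
        (plane G r q' y U - torusE G r β L (plane G r q' y)))| ≤ (C / (R : ℝ) ^ 4) ^ 2 := by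
    intro β hβ R hR hRa L q q' x y hq hq' hL hsep
    have hβ4 : β₄ ≤ β := le_trans (le_max_left _ _) hβ
    have hβ5 : β₅ ≤ β := le_trans (le_max_right _ _) hβ
    refine hceil β hβ4 (a β) (ha_pos β) (ha_le β) (fun s' h2s hs1 hfl => ?_) L q q' x y R hq hq' hR hRa hL hsep
    have := (hcal β hβ5).2 s' (by linarith [ha_pos β]) hs1 hfl.1 hfl.2
    linarith
  -- §3 inheritance by the limit states
  have hceilμ : ∀ β : ℝ, max β₄ β₅ ≤ β → ∀ μ ∈ oddTorusLimitPoints r β, ∀ (R : ℕ), 1 ≤ R →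
      (R : ℝ) * a β ≤ ℓ₄ → ∀ (q q' : Fin 4 × Fin 4) (x y : Fin 4 → ℤ), q.1 < q.2 → q'.1 < q'.2 →
      (∃ k : Fin 4, (2 * (R : ℤ) + 4) ≤ |x k - y k|) →
      |stateMomentStr G r μ 2 ![q, q'] ![x, y]| ≤ (C / (R : ℝ) ^ 4) ^ 2 :=
    fun β hβ μ hμ R hR hRa q q' x y hq hq' hsep =>
      twoPoint_limitState r (hceilU β hβ R hR hRa) hμ q q' x y hq hq' hsep
  -- §4 the admissible profile and its constants `t` (support radius), `δ` (time floor), `Mb` (sup), `Cp`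
  obtain ⟨b, hbc, hbsupp, hbint, hperm, htime⟩ :=
    Summit.QuantumFields.YangMills.Theorems.OnsetTautology.admissibleAtomProfile_proof
  obtain ⟨t, ht0, hbt'⟩ := hbc.isCompact.isBounded.subset_closedBall_lt 0 (0 : EuclideanSpace ℝ (Fin 4))
  have hbt : Function.support (b : EuclideanSpace ℝ (Fin 4) → ℝ) ⊆ Metric.closedBall 0 t :=
    (subset_tsupport _).trans hbt'
  have hne : (tsupport (b : EuclideanSpace ℝ (Fin 4) → ℝ)).Nonempty := by
    by_contra hemp
    rw [Set.not_nonempty_iff_eq_empty, tsupport_eq_empty_iff] at hemp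
    exact hbint (by simp [hemp])
  have hcont : Continuous fun u : EuclideanSpace ℝ (Fin 4) => u 0 :=
    PiLp.continuous_apply (p := 2) (β := fun _ : Fin 4 => ℝ) 0
  obtain ⟨u₀, hu₀mem, hu₀min⟩ := hbc.isCompact.exists_isMinOn hne hcont.continuousOn
  obtain ⟨δ, hδpos, hδ⟩ : ∃ δ : ℝ, 0 < δ ∧ ∀ u, b u ≠ 0 → δ ≤ u 0 :=
    ⟨u₀ 0, hbsupp hu₀mem, fun u hu => (isMinOn_iff.1 hu₀min) u (subset_tsupport _ (Function.mem_support.2 hu))⟩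
  obtain ⟨Mb, hMb⟩ : ∃ Mb : ℝ, ∀ u, |b u| ≤ Mb := ⟨SchwartzMap.seminorm ℝ 0 0 b, fun u => by
    have := SchwartzMap.norm_le_seminorm ℝ b u
    rwa [Real.norm_eq_abs] at this⟩
  obtain ⟨Cp, hCp⟩ := exists_abs_plane_le (G := G) r
  -- §5 the constants of the domination: dilation `K ≥ max 1 (δ/ℓ₄)`, level `E` above both regime bounds
  obtain ⟨K, hK1, hKδ⟩ : ∃ K : ℝ, 1 ≤ K ∧ δ / ℓ₄ ≤ K := ⟨max 1 (δ / ℓ₄), le_max_left _ _, le_max_right _ _⟩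
  have hKpos : 0 < K := lt_of_lt_of_le one_pos hK1
  obtain ⟨E, hEpos, hEc, hEf⟩ : ∃ E : ℝ, 0 < E ∧
      ((2 * ((⌈8 * t / δ⌉₊ + 3 : ℕ) : ℝ) + 1) ^ 4) ^ 2 * Mb ^ 2 * (2 * Cp) ^ 2 < E ∧
      Mb ^ 2 * (C ^ 2 * (4 * (t + δ) / δ) ^ 8) < E := by
    have h1 : 0 ≤ ((2 * ((⌈8 * t / δ⌉₊ + 3 : ℕ) : ℝ) + 1) ^ 4) ^ 2 * Mb ^ 2 * (2 * Cp) ^ 2 := by positivity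
    have h2 : 0 ≤ Mb ^ 2 * (C ^ 2 * (4 * (t + δ) / δ) ^ 8) := by positivity
    refine ⟨((2 * ((⌈8 * t / δ⌉₊ + 3 : ℕ) : ℝ) + 1) ^ 4) ^ 2 * Mb ^ 2 * (2 * Cp) ^ 2 +
      Mb ^ 2 * (C ^ 2 * (4 * (t + δ) / δ) ^ 8) + 1, ?_, ?_, ?_⟩ <;> linarith
  -- §6 ONSET DOMINATION below the dilated unit `K · a β`
  have hdom : ∀ β : ℝ, max β₄ β₅ ≤ β → ∀ μ ∈ oddTorusLimitPoints r β, ∀ s ∈ onsetSet r μ b E, s ≤ K * a β := by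
    intro β hβ μ hμ s hs
    refine not_lt.1 fun hlt => ?_
    obtain ⟨hs0, q, y, hy, hEle⟩ := hs
    haveI : IsProbabilityMeasure μ := by
      have hμ' := hμ
      obtain ⟨S₀, -, hp, -⟩ := hμ'
      exact hp
    by_cases hreg : δ / 8 < s
    · have := rpSquare_le_coarse r μ hbt ht0 hδpos hMb hCp hs0 hreg hy q
      linarith only [this, hEle, hEc]
    · have := rpSquare_le_fine r μ hbt ht0 hδpos hδ hMb (ha_pos β) hℓ₄ hKpos hKδ (hceilμ β hβ μ hμ) hs0
        (not_lt.1 hreg) hlt hy q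
      linarith only [this, hEle, hEf]
  -- §7 the dilated unit `a' := K · a`, floors in the compact currency by exact dilation covariance
  have hev : ∀ᶠ β in atTop, a β ≤ 1 / K := ha0.eventually (eventually_le_nhds (by positivity))
  obtain ⟨β₀, hβ₀⟩ := Filter.eventually_atTop.1 hev
  refine ⟨r, fun β => K * a β, b, E, ⟨hbc, hbsupp, hbint, hperm, htime⟩, hEpos,
    fun β => mul_pos hKpos (ha_pos β), ?_, ?_, ⟨max (max β₄ β₅) β₀, fun β hβ => ⟨?_, fun μ hμ s hs =>
      hdom β (le_trans (le_max_left _ _) hβ) μ hμ s hs⟩⟩⟩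
  · simpa using ha0.const_mul K
  · exact (lowerBoundsK_const_mul_iff r a hKpos).2 hlbK
  · have := hβ₀ β (le_trans (le_max_right _ _) hβ)
    rw [le_div_iff₀ hKpos] at this
    linarith

/-- ★ **Registered stub B6K BY NAME + SIGNATURE** (skeleton REV 4 `g17/rev4/mirror-calibration.rev4.lean`, sha 0c7a8dad, of planner
ym-idea-11 on crux ⟨stmt-QuantumFields-28169⟩): the mirror-calibrated unit in the compact-witness currency. -/
theorem stub_mirrorCalibrationK :
    OnsetFloorsK → Summit.QuantumFields.YangMills.Theses.SquareRootCeilings.SubOnsetTwoPointCeilings →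
      MirrorCalibratedUnitK :=
  mirrorCalibrationK_proof


end Summit.QuantumFields.YangMills.Cruxes.AtomicCalibrationR.MirrorCalibration

end
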